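import Summits.Ventures.AbcSig.Rows.XTemplateB
import Summits.Ventures.AbcSig.Rows.TemplateBC

/-!
# Venture AbcSig — EXTENDED ROW TEMPLATES for `xⁿ + 2^α yⁿ = C z²`, `y` odd, `α = 2` and `α ∈ {4, 5}` (FAMILY C1b)

HONEST FRAMING. Fully PROVED template theorems of a COMPUTATION cell (`pub-abcsig`); CONDITIONAL on named hypotheses,
no claim on ABC or any summit. Companions of `Rows/TemplateBC.lean` / `Rows/XTemplateBC.lean` / `Rows/XTemplateBC6.lean`
for the remaining small-`α` cells of FAMILY C1b ([BS04, Thm 1.2] small-`α` completion, rows `census/rows/C1b/C1b-C13-a2.md`,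
`C1b-C13-a45.md`): for a primitive solution with `y` ODD (so `xy` odd),
* `α ∈ {4, 5}`: `ord₂ B ∈ {4, 5}` — case (iv)₄₅ of [BS04, Lemma 2.1/3.2] after the sign change `c ≡ C (mod 4)`, level `2³·C²`;
* `α = 2`: `ord₂ B = 2`, `B/4 = 1` — case (iii) after the sign change `c ≡ −b (mod 4)`; sub-case (iii)₁ (`b ≡ −C (mod 4)`,
  level `2²·C²`) or (iii)₂ (`b ≡ C (mod 4)`, level `2³·C²`) according to `y mod 4` (the sign of `y` is NOT free).
With `y` EVEN every `α < n` is case (v₇) at level `2C²` (`xbranchBC_v7`). Per-orbit alternative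
`o.Eliminated bs04Allowed n ∨ (M.Excludes N o (famBC α C n P) ∨ M.ExcludesStd N o n)`, final step `xno_solution_in_case`.

* `bs04Level_one_twoPow_iv45 / _iii1 / _iii2` — the levels `8C²`, `4C²`, `8C²`;
* `xbranchBC_iv45` (`α = 4 ∨ α = 5`), `xbranchBC_iii1` (`α = 2`, `4 ∣ y + C`), `xbranchBC_iii2` (`α = 2`, `4 ∣ y − C`),
  `four_dvd_sub_of_not_four_dvd_add` (the split `y ≡ ∓C (mod 4)` for odd `y`, `C`).

Reference: [BS04] M. A. Bennett, C. M. Skinner, Canad. J. Math. 56 (2004) 23–54, §§2–4 and Thm. 1.2.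
-/

namespace Summit.Ventures.AbcSig

/-- Case-(iv)₄₅ Serre level for `(1, 2^α, C)`, `C` odd squarefree, `n ∤ C`: `8·C²`. -/
theorem bs04Level_one_twoPow_iv45 (α C n : ℕ) (hsq : Squarefree C) (hodd : Odd C) (hnC : ¬ n ∣ C) :
    bs04Level .iv₄₅ 1 (2 ^ α) C n = 8 * C ^ 2 := by
  simp only [bs04Level, FreyCase.twoExp, bs04OddLevel_one_twoPow α C n hsq hodd hnC]
  norm_num

/-- Case-(iii)₁ Serre level for `(1, 2^α, C)`, `C` odd squarefree, `n ∤ C`: `4·C²`. -/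
theorem bs04Level_one_twoPow_iii1 (α C n : ℕ) (hsq : Squarefree C) (hodd : Odd C) (hnC : ¬ n ∣ C) :
    bs04Level .iii₁ 1 (2 ^ α) C n = 4 * C ^ 2 := by
  simp only [bs04Level, FreyCase.twoExp, bs04OddLevel_one_twoPow α C n hsq hodd hnC]
  norm_num

/-- Case-(iii)₂ Serre level for `(1, 2^α, C)`, `C` odd squarefree, `n ∤ C`: `8·C²`. -/
theorem bs04Level_one_twoPow_iii2 (α C n : ℕ) (hsq : Squarefree C) (hodd : Odd C) (hnC : ¬ n ∣ C) :
    bs04Level .iii₂ 1 (2 ^ α) C n = 8 * C ^ 2 := by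
  simp only [bs04Level, FreyCase.twoExp, bs04OddLevel_one_twoPow α C n hsq hodd hnC]
  norm_num

/-- Shared elementary facts for `y` odd and `1 ≤ α`: `C` odd as an integer, `z` odd, `x` odd, `xy` odd. -/
theorem oddFacts_of_odd_y {α C n : ℕ} {x y z : ℤ} (hCodd : Odd C) (hα : 1 ≤ α)
    (hsol : IsPrimitiveSolution 1 (2 ^ α) C n x y z) (hy : ¬ 2 ∣ y) :
    ¬ 2 ∣ (C : ℤ) ∧ ¬ 2 ∣ z ∧ ¬ 2 ∣ x * y := by
  have hCoddZ : ¬ 2 ∣ (C : ℤ) := by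
    intro h
    have h' : (2 : ℕ) ∣ C := by exact_mod_cast h
    exact (Nat.not_even_iff_odd.mpr hCodd) (even_iff_two_dvd.mpr h')
  have h2B : (2 : ℤ) ∣ ((2 ^ α : ℕ) : ℤ) := by
    push_cast
    exact dvd_pow_self 2 (by omega)
  have hBb : 2 ∣ ((2 ^ α : ℕ) : ℤ) * y := Dvd.dvd.mul_right h2B _
  have hCz := odd_Cc_of_two_dvd_Bb hsol hBb
  have hz : ¬ 2 ∣ z := fun h => hCz (Dvd.dvd.mul_left h _)
  have hx : ¬ 2 ∣ x := by
    have := odd_Aa_of_two_dvd_Bb hsol hBb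
    simpa using this
  have hxy : ¬ 2 ∣ x * y := by
    intro h
    rcases Int.prime_two.dvd_mul.mp h with h' | h'
    · exact hx h'
    · exact hy h'
  exact ⟨hCoddZ, hz, hxy⟩

/-- `n ∤ 1 · 2^α · C` for a prime `n ≥ 7` with `n ∤ C`. -/
theorem not_dvd_one_twoPow_C {α C n : ℕ} (hn : n.Prime) (h7 : 7 ≤ n) (hnC : ¬ n ∣ C) : ¬ n ∣ 1 * 2 ^ α * C := by
  intro h
  rw [one_mul] at h
  rcases (Nat.Prime.dvd_mul hn).mp h with h2 | hC
  · have := (Nat.prime_dvd_prime_iff_eq hn Nat.prime_two).mp (hn.dvd_of_dvd_pow h2)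
    omega
  · exact hnC hC

/-- For odd `y` and odd `C`: if `y ≢ −C (mod 4)` then `y ≡ C (mod 4)` (the split between (iii)₁ and (iii)₂). -/
theorem four_dvd_sub_of_not_four_dvd_add {y : ℤ} {C : ℕ} (hy : ¬ 2 ∣ y) (hC : Odd C) (h : ¬ (4 : ℤ) ∣ y + C) :
    (4 : ℤ) ∣ y - C := by
  obtain ⟨k, hk⟩ := hC
  subst hk
  push_cast at h ⊢
  omega

/-- EXTENDED **Branch (iv)₄₅, `y` odd, `α ∈ {4, 5}`**: level `8·C²`. -/
theorem xbranchBC_iv45 (α C : ℕ) (hα : α = 4 ∨ α = 5) (hsq : Squarefree C) (hCodd : Odd C) (M : NewformModel)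
    (hP : M.BS04Package) {orbs : List OrbitData} (hD : M.DataComplete (8 * C ^ 2) orbs)
    (n : ℕ) (hn : n.Prime) (h7 : 7 ≤ n) (hnC : ¬ n ∣ C)
    (hS : ∀ o ∈ orbs, (∀ e ∈ o.coeffs, e.ell.Prime ∧ e.ell ≠ 2 ∧ ¬ e.ell ∣ 8 * C ^ 2) ∧
      (o.Eliminated bs04Allowed n ∨ (M.Excludes (8 * C ^ 2) o (famBC α C n (fun _ b => ¬ 2 ∣ b)) ∨
        M.ExcludesStd (8 * C ^ 2) o n)))
    (x y z : ℤ) (hy : ¬ 2 ∣ y) (h1 : x * y ≠ 1) (h2 : x * y ≠ -1) :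
    ¬ IsPrimitiveSolution 1 (2 ^ α) C n x y z := by
  intro hsol
  have hCpos : 0 < C := hCodd.pos
  obtain ⟨hCoddZ, hz, hxy⟩ := oddFacts_of_odd_y hCodd (by omega) hsol hy
  obtain ⟨z', hz'sgn, hz'⟩ := exists_sign_sub_four_dvd z C hz hCoddZ
  have hsol' : IsPrimitiveSolution 1 (2 ^ α) C n x y z' := hsol.of_sign hz'sgn
  have hB : OrdTwoEq ((2 ^ α : ℕ) : ℤ) 4 ∨ OrdTwoEq ((2 ^ α : ℕ) : ℤ) 5 := by
    rcases hα with rfl | rfl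
    · exact Or.inl ⟨by norm_num, by norm_num⟩
    · exact Or.inr ⟨by norm_num, by norm_num⟩
  have hcase : FreyCase.Holds .iv₄₅ 1 (2 ^ α) C n x y z' := ⟨hxy, hB, hz'⟩
  have hαn : α < n := by omega
  exact xno_solution_in_case M hP ⟨1, 2 ^ α, C, n, x, y, z'⟩ .iv₄₅ (8 * C ^ 2) one_pos (by positivity) hCpos hsq hn h7
    (not_dvd_one_twoPow_C hn h7 hnC) (nthPowerFree_one_twoPow α n hαn (by omega)) hsol' h1 h2 hcase
    (bs04Level_one_twoPow_iv45 α C n hsq hCodd hnC) hD (famBC α C n (fun _ b => ¬ 2 ∣ b)) ⟨rfl, rfl, rfl, rfl, hy⟩ hS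

/-- EXTENDED **Branch (iii)₁, `y` odd, `α = 2`, `y ≡ −C (mod 4)`**: level `4·C²`. -/
theorem xbranchBC_iii1 (C : ℕ) (hsq : Squarefree C) (hCodd : Odd C) (M : NewformModel)
    (hP : M.BS04Package) {orbs : List OrbitData} (hD : M.DataComplete (4 * C ^ 2) orbs)
    (n : ℕ) (hn : n.Prime) (h7 : 7 ≤ n) (hnC : ¬ n ∣ C)
    (hS : ∀ o ∈ orbs, (∀ e ∈ o.coeffs, e.ell.Prime ∧ e.ell ≠ 2 ∧ ¬ e.ell ∣ 4 * C ^ 2) ∧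
      (o.Eliminated bs04Allowed n ∨ (M.Excludes (4 * C ^ 2) o (famBC 2 C n (fun _ b => (4 : ℤ) ∣ b + C)) ∨
        M.ExcludesStd (4 * C ^ 2) o n)))
    (x y z : ℤ) (hyC : (4 : ℤ) ∣ y + C) (h1 : x * y ≠ 1) (h2 : x * y ≠ -1) :
    ¬ IsPrimitiveSolution 1 (2 ^ 2) C n x y z := by
  intro hsol
  have hCpos : 0 < C := hCodd.pos
  have hCoddZ' : ¬ 2 ∣ (C : ℤ) := by
    intro h
    have h' : (2 : ℕ) ∣ C := by exact_mod_cast h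
    exact (Nat.not_even_iff_odd.mpr hCodd) (even_iff_two_dvd.mpr h')
  have hy : ¬ 2 ∣ y := by
    intro h
    have : (2 : ℤ) ∣ y + C := (show (2 : ℤ) ∣ 4 by norm_num).trans hyC
    exact hCoddZ' (by simpa using dvd_sub this h)
  obtain ⟨hCoddZ, hz, hxy⟩ := oddFacts_of_odd_y hCodd (by omega) hsol hy
  obtain ⟨z', hz'sgn, hz'⟩ := exists_sign_sub_four_dvd_int z (-y) hz (by simpa using hy)
  have hsol' : IsPrimitiveSolution 1 (2 ^ 2) C n x y z' := hsol.of_sign hz'sgn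
  have hB : OrdTwoEq ((2 ^ 2 : ℕ) : ℤ) 2 := ⟨by norm_num, by norm_num⟩
  have hc : (4 : ℤ) ∣ z' + y * ((2 ^ 2 / 4 : ℕ) : ℤ) := by
    have : (4 : ℤ) ∣ z' + y := by simpa [sub_neg_eq_add] using hz'
    simpa using this
  have hb : (4 : ℤ) ∣ y + ((2 ^ 2 / 4 : ℕ) : ℤ) * C := by simpa using hyC
  have hcase : FreyCase.Holds .iii₁ 1 (2 ^ 2) C n x y z' := ⟨hxy, hB, hc, hb⟩
  exact xno_solution_in_case M hP ⟨1, 2 ^ 2, C, n, x, y, z'⟩ .iii₁ (4 * C ^ 2) one_pos (by positivity) hCpos hsq hn h7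
    (not_dvd_one_twoPow_C hn h7 hnC) (nthPowerFree_one_twoPow 2 n (by omega) (by omega)) hsol' h1 h2 hcase
    (bs04Level_one_twoPow_iii1 2 C n hsq hCodd hnC) hD (famBC 2 C n (fun _ b => (4 : ℤ) ∣ b + C))
    ⟨rfl, rfl, rfl, rfl, hyC⟩ hS

/-- EXTENDED **Branch (iii)₂, `y` odd, `α = 2`, `y ≡ C (mod 4)`**: level `8·C²`. -/
theorem xbranchBC_iii2 (C : ℕ) (hsq : Squarefree C) (hCodd : Odd C) (M : NewformModel)
    (hP : M.BS04Package) {orbs : List OrbitData} (hD : M.DataComplete (8 * C ^ 2) orbs)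
    (n : ℕ) (hn : n.Prime) (h7 : 7 ≤ n) (hnC : ¬ n ∣ C)
    (hS : ∀ o ∈ orbs, (∀ e ∈ o.coeffs, e.ell.Prime ∧ e.ell ≠ 2 ∧ ¬ e.ell ∣ 8 * C ^ 2) ∧
      (o.Eliminated bs04Allowed n ∨ (M.Excludes (8 * C ^ 2) o (famBC 2 C n (fun _ b => (4 : ℤ) ∣ b - C)) ∨
        M.ExcludesStd (8 * C ^ 2) o n)))
    (x y z : ℤ) (hyC : (4 : ℤ) ∣ y - C) (h1 : x * y ≠ 1) (h2 : x * y ≠ -1) :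
    ¬ IsPrimitiveSolution 1 (2 ^ 2) C n x y z := by
  intro hsol
  have hCpos : 0 < C := hCodd.pos
  have hCoddZ' : ¬ 2 ∣ (C : ℤ) := by
    intro h
    have h' : (2 : ℕ) ∣ C := by exact_mod_cast h
    exact (Nat.not_even_iff_odd.mpr hCodd) (even_iff_two_dvd.mpr h')
  have hy : ¬ 2 ∣ y := by
    intro h
    have : (2 : ℤ) ∣ y - C := (show (2 : ℤ) ∣ 4 by norm_num).trans hyC
    exact hCoddZ' (by simpa using dvd_sub h this)
  obtain ⟨hCoddZ, hz, hxy⟩ := oddFacts_of_odd_y hCodd (by omega) hsol hy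
  obtain ⟨z', hz'sgn, hz'⟩ := exists_sign_sub_four_dvd_int z (-y) hz (by simpa using hy)
  have hsol' : IsPrimitiveSolution 1 (2 ^ 2) C n x y z' := hsol.of_sign hz'sgn
  have hB : OrdTwoEq ((2 ^ 2 : ℕ) : ℤ) 2 := ⟨by norm_num, by norm_num⟩
  have hc : (4 : ℤ) ∣ z' + y * ((2 ^ 2 / 4 : ℕ) : ℤ) := by
    have : (4 : ℤ) ∣ z' + y := by simpa [sub_neg_eq_add] using hz'
    simpa using this
  have hb : (4 : ℤ) ∣ y - ((2 ^ 2 / 4 : ℕ) : ℤ) * C := by simpa using hyC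
  have hcase : FreyCase.Holds .iii₂ 1 (2 ^ 2) C n x y z' := ⟨hxy, hB, hc, hb⟩
  exact xno_solution_in_case M hP ⟨1, 2 ^ 2, C, n, x, y, z'⟩ .iii₂ (8 * C ^ 2) one_pos (by positivity) hCpos hsq hn h7
    (not_dvd_one_twoPow_C hn h7 hnC) (nthPowerFree_one_twoPow 2 n (by omega) (by omega)) hsol' h1 h2 hcase
    (bs04Level_one_twoPow_iii2 2 C n hsq hCodd hnC) hD (famBC 2 C n (fun _ b => (4 : ℤ) ∣ b - C))
    ⟨rfl, rfl, rfl, rfl, hyC⟩ hS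

end Summit.Ventures.AbcSig
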